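import Summits.BirchSwinnertonDyer.BirchSwinnertonDyer.Theorems.BiquadraticEisensteinDescentKatzWaldspurgerFrameCMInertBadFromPrint
import Summits.BirchSwinnertonDyer.BirchSwinnertonDyer.Theorems.BiquadraticEisensteinDescentKatzWaldspurgerFrameCMInertBadFlatLZZRoad
import Summits.BirchSwinnertonDyer.BirchSwinnertonDyer.Theorems.BiquadraticEisensteinDescentKatzWaldspurgerFrameCMInertBadFlatZeroRigidity
import Summits.BirchSwinnertonDyer.Rank1Residual.X11b.RouteR1LogOmega
import Summits.BirchSwinnertonDyer.Rank1Residual.Partition.AnticyclotomicControlJSWEmbAt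
import Literature.NumberTheory.EllipticCurves.ComplexMultiplicationNotSemistable
import Literature.NumberTheory.EllipticCurves.ManinConstantQuadraticTwistClassCertificate
import Literature.NumberTheory.EllipticCurves.BSDQuadraticDescentArchimedeanProofs
import HarnessLib

/-!
# Route `BiquadraticEisensteinDescent` (W-ALL row 12 · K12i): crux (W♭) `KatzWaldspurgerFrameCMInertBadFlat`
# (stmt-BirchSwinnertonDyer-20453) PROVED modulo ONE further printed input — Liu–Zhang–Zhang 2018 Thm 1.5.1 ∧ 1.5.3
# at an additive prime (`LiuZhangZhang2018.thm151_thm153_modularCurve_heegnerVector_additive`, p518041)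

Prover seat bsd-wall-bed-p2 (g2), 2026-08-27. HONEST FRAMING: THEOREMS ONLY (0 definitions, 0 named facts, 0 sorry).
The main theorem `katzWaldspurgerFrameCMInertBadFlat_of_lzz` has type
`thm151_thm153_modularCurve_heegnerVector_additive → KatzWaldspurgerFrameCMInertBadFlat`, i.e. (W♭) is a THEOREM
granted two refereed named facts — Hsieh 2014 Thm A at any level (W♭'s own antecedent) and LZZ 2018 §1.5 at `p² ∣ N`
(the tenure planner's rev-9 antecedent `LiuZhangZhangAdditiveInput`; at rev 9 the restated crux
`KatzWaldspurgerFrameCMInertBadFlatOfLZZ := Hsieh → LZZ-additive → <W♭ body>` is closed by `exact` from this theorem).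
It is CONDITIONAL on those two facts and on nothing else: no Gross–Zagier, no `R₀`-descent, no exact-unit claim.

## The proof (all tree theorems; the two Literature facts enter as hypotheses)

At a datum of (W♭) (`W` CM of analytic rank `1`, `p ≥ 5` inert in the CM field and bad — hence ADDITIVE:
`¬ Mult` for a CM curve, `Rank1Residual.not_mult_of_hasCM`, so `p² ∣ N`; `K′` imaginary quadratic Heegner field with
`|d_{K′}| > 4`, so `p` splits in `K′` and `d_{K′} < −4`; a Heegner datum `(Dt, H, ι, P)` with `p ∤ c(Dt)`; `(κ, γ, 𝔭)`):
1. the ♭-FRAME `(f, ι′, Ω_K, Ω_p, Q)` is bed-p2 g0's `…FromPrint.exists_frameInt_of_thmA_anyLevel` (p508877) from the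
   Hsieh input;
2. the LZZ input gives the BDP display at the virtual periods EXACTLY, `𝓛(χ)·C⁻¹·r(σ𝔭)^{−a}`, with
   `𝓛(𝟙)·C⁻¹ = u·(log_{ω_E} P)²`, `‖u‖ = 1` (`…LZZRoad.exists_exactDisplay_of_thm151_thm153_additive`, read at the
   embedding `e = embAt K p 𝔭` of the frame's prime: `Halves.logOmega = Castella2018.padicLogOmega`, `rfl`), and its
   continuous form (`…exists_continuousDisplay_of_thm151_thm153_additive`);
3. if `P` has INFINITE order, `log_{ω_E} P ≠ 0` (`X11b.R1.logOmega_ne_zero`), the limit `c = u·(log P)² ≠ 0`, and the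
   X11b one-sided rigidity `X11b.intSeries_constantCoeff_eq_of_isBDPLFunctionInt_of_continuousValues` gives
   `[T⁰]Q = c`; if `P` is TORSION, `log_{ω_E} P = 0` (`X11b.R1.logOmega_eq_zero_iff`), so `𝓛(𝟙) = 0` and the `c = 0`
   rigidity `…ZeroRigidity.intSeries_constantCoeff_eq_zero_of_isBDPLFunctionInt_of_exactDisplay` gives `[T⁰]Q = 0 =
   u·(log P)²`. Either way `Q(𝟙) = [T⁰]Q = u·(log_{ω_E} P)²` with `‖u‖ = 1 ≤ 1` (in fact the exact-unit statement).

Nothing is booked here beyond the crux: BSD for the corner follows only through the route's `closes` with its other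
cruxes (E♭°, C′, KS, R₃, R₅₇, PUB). References: [LiuZhangZhang2018] Duke Math. J. 167 (2018) Thm 1.5.1, Thm 1.5.3;
[Hsieh2014] Doc. Math. 19 (2014) Thm A; [Castella2018] Thms. 3.1–3.2 (the display's currency).
-/

set_option autoImplicit false

-- D-0017 layout: summit = sub-problem, so `Summit.BirchSwinnertonDyer.BirchSwinnertonDyer.…` is the
-- mandated namespace of Theorems files (same option as the route's sibling Theorems files).
set_option linter.dupNamespace false

noncomputable section

open scoped Classical Topology NumberField

namespace Summit.BirchSwinnertonDyer.BirchSwinnertonDyer.Theorems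

open Filter WeierstrassCurve NumberField IsDedekindDomain Field PowerSeries
  Literature.NumberTheory.EllipticCurves Literature.NumberTheory.EllipticCurves.ModularForms
  Literature.NumberTheory.EllipticCurves.Rank1Residual Literature.NumberTheory.EllipticCurves.LiuZhangZhang2018
  Literature.NumberTheory.GaloisRepresentations
  Summit.BirchSwinnertonDyer.Rank1Residual Summit.BirchSwinnertonDyer.Rank1Residual.X11b
  Summit.BirchSwinnertonDyer.Rank1Residual.X11b.Halves
  Summit.BirchSwinnertonDyer.BirchSwinnertonDyer.Theses.BiquadraticEisensteinDescent
  BiquadraticEisensteinDescentKatzWaldspurgerFrameCMInertBadFlatLZZRoad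
  BiquadraticEisensteinDescentKatzWaldspurgerFrameCMInertBadFlatZeroRigidity

/-- **The value of a ♭-frame at `𝟙` at a (W♭)-datum, granted the LZZ additive input** (module docstring, steps 2–3):
for `p ≠ 2` with `p² ∣ N_W`, `K` imaginary quadratic Heegner field with `d_K < −4`, a Heegner datum `(Dt, H, ι_K, P)`
with `p ∤ c(Dt)`, `(κ, γ)` anticyclotomic, a degree-one prime `𝔭 ∋ p`, a newform `f`, an embedding datum `ι′` inducing
`𝔭` and ANY ♭-frame `(Ω_K, Ω_p, Q)`: `Q(𝟙) = u·(log_{ω_E} P)²` for a UNIT `u` — both for `P` of infinite order (X11b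
one-sided rigidity, `c ≠ 0`) and for torsion `P` (`c = 0` rigidity; then both sides vanish).
CONDITIONAL on the named fact `hL`. [cite: LiuZhangZhang2018, Thm 1.5.1 and Thm 1.5.3 (Duke Math. J. 167 pp. 748–749)]
[cite: Castella2018, Thm. 3.1–3.2 (arXiv:1704.06608 p. 9) (the frame's display)] -/
theorem katzWaldspurgerFrameCMInertBadFlat_value_of_lzz {p : ℕ} [Fact p.Prime]
    (hL : thm151_thm153_modularCurve_heegnerVector_additive)
    (ι' : PadicAlgCl p ≃+* ℂ) (W : WeierstrassCurve ℚ) [W.IsElliptic] [W.IsGloballyMinimal]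
    (K : Type) [Field K] [NumberField K] (𝔭 : HeightOneSpectrum (𝓞 K))
    (κ : ZpExtension K p) (γ : absoluteGaloisGroup K) {N : ℕ} [NeZero N]
    (Dt : ModularParametrizationData W N) (H : HeegnerDatum N (NumberField.discr K))
    (ιK : K →+* ℂ) (P : (W.baseChange K).toAffine.Point) (f : CuspForm (CongruenceSubgroup.Gamma0 N) 2)
    (hp2 : p ≠ 2) (hN : W.conductorNorm ℤ = N) (hp2N : p ^ 2 ∣ N) (hK : IsImaginaryQuadratic K)
    (hd4 : NumberField.discr K < -4) (hsplit : ((Ideal.span {(p : ℤ)}).primesOver (𝓞 K)).ncard = 2)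
    (h𝔭 : ((p : ℕ) : 𝓞 K) ∈ 𝔭.asIdeal) (he : 𝔭.asIdeal.ramificationIdx (𝓞 ℚ) = 1)
    (hf : 𝔭.asIdeal.inertiaDeg (𝓞 ℚ) = 1)
    (hι : ∀ (w' : InfinitePlace K) (k : 𝓞 K), k ∈ 𝔭.asIdeal ↔ ‖ι'.symm (w'.embedding (k : K))‖ < 1)
    (hHN : SatisfiesHeegnerHypothesis N K) (hκ : κ.IsAnticyclotomic) (hγ : κ.IsTopGenerator γ)
    (hfW : IsNewformOf W f) (hcM : ¬ (p : ℤ) ∣ Dt.c)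
    (hP : WeierstrassCurve.Affine.Point.map ιK.toRatAlgHom P = heegnerPointComplex Dt H)
    {ΩK : ℂ} {Ωp : ℂ_[p]} {Q : PowerSeries 𝓞_ℂ_[p]} (hΩK : ΩK ≠ 0) (hΩp : Ωp ≠ 0)
    (hQ : R1.IsBDPLFunctionInt p ι' 𝔭 κ γ f ΩK Ωp Q) :
    ∃ u : ℂ_[p], ‖u‖ = 1 ∧ IntSeries.HasValueAt Q 0
      (u * (algebraMap ℚ_[p] ℂ_[p] (logOmega W p (embAt K p 𝔭 h𝔭 he hf) P)) ^ 2) := by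
  set e : K →+* ℚ_[p] := embAt K p 𝔭 h𝔭 he hf with hedef
  have hemb : ∀ k : 𝓞 K, k ∈ 𝔭.asIdeal ↔ ‖e (k : K)‖ < 1 := mem_asIdeal_iff_norm_embAt_lt_one 𝔭 h𝔭 he hf
  -- the exact display (LZZ road) at the embedding of the frame's prime
  obtain ⟨Ωp₀, a, C, u, σ𝔭, hΩp₀, hrad, hC, hu, hval, hdisp⟩ :=
    exists_exactDisplay_of_thm151_thm153_additive hL ι' W K 𝔭 κ γ Dt H ιK e P f hp2 hN hp2N hK hd4 hsplit h𝔭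
      hι hHN hκ hγ hfW hcM hP hemb
  have hlog : Castella2018.padicLogOmega W p e P = logOmega W p e P := (R1.logOmega_eq_padicLogOmega W p e P).symm
  rw [hlog] at hval
  refine ⟨u, hu, ?_⟩
  by_cases htor : IsOfFinAddOrder P
  · -- torsion: `log P = 0`, `𝓛(𝟙) = a 0 = 0`, hence `[T⁰]Q = 0`
    have hlog0 : logOmega W p e P = 0 := (R1.logOmega_eq_zero_iff W p e P).mpr htor
    have ha0 : a 0 = 0 := by
      rw [hlog0, map_zero, zero_pow two_ne_zero, mul_zero] at hval
      rcases mul_eq_zero.mp hval with h | h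
      · exact h
      · exact absurd h (inv_ne_zero hC)
    have hQ0 : constantCoeff Q = 0 :=
      intSeries_constantCoeff_eq_zero_of_isBDPLFunctionInt_of_exactDisplay hp2 hK hκ hγ one_ne_zero hΩK hΩp₀
        hrad ha0 hC hdisp hQ
    have h := R1.intSeries_hasValueAt_zero p Q
    rw [hQ0] at h
    rw [hlog0, map_zero, zero_pow two_ne_zero, mul_zero]
    simpa using h
  · -- infinite order: the continuous display tends to `c = u·(log P)² ≠ 0`; one-sided rigidity
    have hlogne : logOmega W p e P ≠ 0 := R1.logOmega_ne_zero W p e htor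
    have hu0 : u ≠ 0 := fun h0 ↦ by rw [h0, norm_zero] at hu; exact zero_ne_one hu
    have hc0 : u * (algebraMap ℚ_[p] ℂ_[p] (logOmega W p e P)) ^ 2 ≠ 0 :=
      mul_ne_zero hu0 (pow_ne_zero _ ((map_ne_zero _).mpr hlogne))
    -- the continuous display from the exact one (same `u`)
    have hcont : ∀ (φ : ℕ → HeckeCharacter K) (n : ℕ → ℕ) (r : ℕ → FramedGaloisRep K (PadicAlgCl p) 1),
        (∀ k, 0 < n k) → (∀ k (v : HeightOneSpectrum (𝓞 K)), (φ k).IsUnramifiedAt v) →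
        (∀ k, (φ k).HasInfinityType (fun _ ↦ (n k : ℤ)) (fun _ ↦ -(n k : ℤ))) →
        (∀ k, IsPAdicAvatarOf ι' (φ k) (r k)) → (∀ k, FactorsThroughZp κ (r k)) →
        Tendsto (fun k ↦ avatarValueAt (r k) γ) atTop (𝓝 1) →
        Tendsto (fun k ↦ ((ι'.symm (bdpInterpolationValue p f 𝔭 (φ k) (n k) 1) :
          PadicAlgCl p) : ℂ_[p]) * Ωp₀ ^ (4 * n k)) atTop
          (𝓝 (u * (algebraMap ℚ_[p] ℂ_[p] (logOmega W p e P)) ^ 2)) := by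
      intro φ n r hn hunr hinf havt hfac hlimγ
      choose L hLs hdL using fun k ↦ hdisp (φ k) (n k) (r k) (hn k) (hunr k) (hinf k) (havt k) (hfac k)
      have hσ : Tendsto (fun k ↦ avatarValueAt (r k) σ𝔭) atTop (𝓝 1) := by
        rw [Metric.tendsto_nhds]
        intro ε hε
        filter_upwards [X2.PNewDisplay.eventually_forall_norm_avatarValueAt_sub_one_lt hγ hfac hlimγ hε]
          with k hk
        rw [dist_eq_norm]
        exact hk σ𝔭
      obtain ⟨B, hB⟩ := hrad (1 / 2) (by norm_num) (by norm_num)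
      have hx : Tendsto (fun k ↦ avatarValueAt (r k) γ - 1) atTop (𝓝 0) := by
        have h := hlimγ.sub_const 1
        rwa [sub_self] at h
      have hlimL : Tendsto L atTop (𝓝 (a 0)) :=
        X2.tendsto_value_of_tendsto_zero_of_coeff_bound (ρ := 1 / 2) (by norm_num) hB hx hLs
      have hlim : Tendsto (fun k ↦ L k * C⁻¹ * (avatarValueAt (r k) σ𝔭 ^ (N.factorization p))⁻¹) atTop
          (𝓝 (a 0 * C⁻¹ * ((1 : ℂ_[p]) ^ (N.factorization p))⁻¹)) :=
        (hlimL.mul tendsto_const_nhds).mul (((hσ.pow _).inv₀ (by simp)))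
      rw [show (fun k ↦ ((ι'.symm (bdpInterpolationValue p f 𝔭 (φ k) (n k) 1) : PadicAlgCl p) : ℂ_[p]) *
          Ωp₀ ^ (4 * n k)) = (fun k ↦ L k * C⁻¹ * (avatarValueAt (r k) σ𝔭 ^ (N.factorization p))⁻¹) from
        funext hdL]
      simpa only [one_pow, inv_one, mul_one, hval] using hlim
    have heq := intSeries_constantCoeff_eq_of_isBDPLFunctionInt_of_continuousValues hp2 hK hκ hγ one_ne_zero
      hΩK hΩp₀ hΩp hcont hc0 hQ
    rw [← heq]
    exact R1.intSeries_hasValueAt_zero p Q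

/-- **(W♭) `KatzWaldspurgerFrameCMInertBadFlat` (stmt-BirchSwinnertonDyer-20453) granted the LZZ additive input.**
`thm151_thm153_modularCurve_heegnerVector_additive → KatzWaldspurgerFrameCMInertBadFlat`: at every datum of the crux
the ♭-frame of `…FromPrint.exists_frameInt_of_thmA_anyLevel` (Hsieh input, W♭'s own antecedent) has value
`u·(log_{ω_E} P)²` at `𝟙` with `‖u‖ = 1 ≤ 1` (`katzWaldspurgerFrameCMInertBadFlat_value_of_lzz`). The binders of W♭
supply everything the road needs: `p ≥ 5` is odd; CM + bad ⟹ additive (`Rank1Residual.not_mult_of_hasCM`,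
`hasGoodReductionAtPrime_or_hasMultiplicativeReductionAtPrime_of_not_sq_dvd_conductorNorm`) ⟹ `p² ∣ N`; the Heegner
hypothesis splits `p`; `|d_K′| > 4` and imaginary quadratic ⟹ `d_K′ < −4`. The admissibility, analytic-rank and
twisted-`L`-value binders are not used. CONDITIONAL on the two refereed named facts (Hsieh any-level = the
antecedent; LZZ additive = `hL`); equal, up to currying, to the rev-9 decl `KatzWaldspurgerFrameCMInertBadFlatOfLZZ`.
[cite: LiuZhangZhang2018, Thm 1.5.1 and Thm 1.5.3 (Duke Math. J. 167 pp. 748–749)]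
[cite: Hsieh2014, Thm. A p. 712 (Doc. Math. 19) = Thm. 1 (arXiv:1112.1580 pp. 3–4)] -/
theorem katzWaldspurgerFrameCMInertBadFlat_of_lzz (hL : thm151_thm153_modularCurve_heegnerVector_additive) :
    KatzWaldspurgerFrameCMInertBadFlat := by
  intro hA W _ _ p _ _ K _ _ Dt H ι P hCM _ hp5 _ hbad hK hHN hd4 _ hP hcM _ κ hκ γ hγ 𝔭 h𝔭 he hf
  have hp : p.Prime := Fact.out
  have hp2 : p ≠ 2 := by omega
  have hpN : p ∣ W.conductorNorm ℤ := (W.dvd_conductorNorm_iff_not_hasGoodReductionAtPrime p).mpr hbad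
  -- CM + bad ⟹ additive: `p² ∣ N`
  have hp2N : p ^ 2 ∣ W.conductorNorm ℤ := by
    by_contra h
    rcases hasGoodReductionAtPrime_or_hasMultiplicativeReductionAtPrime_of_not_sq_dvd_conductorNorm (V := W) h
      with hg | hm
    · exact hbad hg
    · exact not_mult_of_hasCM W hCM p hm
  have hsplit : ((Ideal.span {(p : ℤ)}).primesOver (𝓞 K)).ncard = 2 := hHN p hp hpN
  -- `d_K′ < −4`
  have hd4' : NumberField.discr K < -4 := by
    have hneg : NumberField.discr K < 0 := by
      haveI : IsTotallyComplex K := hK.2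
      exact discr_neg_of_finrank_eq_two K hK.1
    have habs : ((NumberField.discr K).natAbs : ℤ) = -NumberField.discr K := Int.ofNat_natAbs_of_nonpos hneg.le
    have : (4 : ℤ) < ((NumberField.discr K).natAbs : ℤ) := by exact_mod_cast hd4
    omega
  -- the ♭-frame from the Hsieh input (bed-p2 g0, p508877)
  obtain ⟨f, hfW, ι', hι', ΩK, Ωp, Q, hΩK, hQ⟩ :=
    BiquadraticEisensteinDescentKatzWaldspurgerFrameCMInertBadFromPrint.exists_frameInt_of_thmA_anyLevel hA W p K Dt
      hp5 hbad hK hHN κ hκ γ 𝔭 h𝔭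
  have hΩp0 : ((Ωp : unrIntegers p) : ℂ_[p]) ≠ 0 := fun h0 ↦ by
    have h1 := norm_coe_units_unrIntegers p Ωp
    rw [h0, norm_zero] at h1
    exact zero_ne_one h1
  obtain ⟨u, hu, hval⟩ := katzWaldspurgerFrameCMInertBadFlat_value_of_lzz hL ι' W K 𝔭 κ γ Dt H ι P f hp2 rfl hp2N hK
    hd4' hsplit h𝔭 he hf hι' hHN hκ hγ.out hfW hcM hP hΩK hΩp0 hQ
  exact ⟨f, hfW, ι', hι', ΩK, Ωp, Q, hΩK, hQ, u, hu.le, hval⟩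

end Summit.BirchSwinnertonDyer.BirchSwinnertonDyer.Theorems

end
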